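import Mathlib
import HarnessLib
import Summits.HubbardSuperconductivity.HubbardSuperconductivity.Theorems.KLProgrammeKLRegimeEnginePairTransferStep7AnalyticResolvedBudgetGridSplitPinnedAll
import Summits.HubbardSuperconductivity.HubbardSuperconductivity.Theorems.KLProgrammeKLRegimeEnginePairTransferBudgetScalarRowConstTop
import Summits.HubbardSuperconductivity.HubbardSuperconductivity.Theorems.KLProgrammeKLRegimeEnginePairTransferBudgetScalarRowConst
import Summits.HubbardSuperconductivity.HubbardSuperconductivity.Theorems.KLProgrammeKLRegimeEnginePairTransferBudgetScalarRowsPinned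
import Summits.HubbardSuperconductivity.HubbardSuperconductivity.Theorems.KLProgrammeKLRegimeEnginePairTransferMemberPHTailPhGain
import Summits.HubbardSuperconductivity.HubbardSuperconductivity.Theorems.KLProgrammeKLRegimeEngineV8DoorGfr

/-!
# Route `KLProgramme` — ENGINE item stmt-HubbardSuperconductivity-20437 `KLRegimeEngineV17F2`, class #5 rev 3 — «88b» THE PINNED PAIR (KNOWN-RISK #3 / located-risk #9):
# producer `pairTransferStep7_of_analytic_resolved_sized_pinned_all` = `pairTransferStep7_of_analytic_resolved_sized_all` ((B2)(B3) discharged from SIZE hypotheses everywhere (pinned pair: rows (T2p)/(T3p)), (B4) off the pinned pair; the pinned (B4″) stays the closer's ONE raw row) over the pinned-pair spine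
# (cell gate-hubbard-kl, seat hubbard-kl-k3c1-p1 g17; CLASS5-RESOLVED-STEP.md §17)

WHY.  The pinned-pair spine (…Step7AnalyticResolvedConvKPinnedAll) carries, per pair, two extra GUARDED rows — for `1 ≤ n`, `j′ = n+1` and inside the forward windows the SIGNED
direct/crossed `D`-sums in the five-slot scalar form `(Klam U)²·(z·4^{−(n+1)} + h·4^{−(n_β−n)} + w·2⁻ⁿ + l·L⁻¹ + t·min)` (nonneg binders `zD hD wD lD tD zX hX wX lX tX`) — and in `Ran`
the guarded `if [pinned ∧ window] then FIVE-SLOT/((Λₙ−Λₙ₊₁)(βL²)⁻³) else M4²·WD` in place of `M4²·WD₁`, `M4²·WD₂`.  THIS FILE is `pairTransferStep7_of_analytic_resolved_sized_all` (p671935, row 93) re-keyed on that spine: statement =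
the parent's with the ten binders, the nonnegativity + two pinned rows and the guarded `Ran` entries threaded verbatim; proof = the parent's text (the pinned rows pass through).
NEW HERE: off the pinned pair (`n = 0`, interior `n+2 ≤ j′`, crossed top edge) the pinned constants reduce to row 87's (`if_neg` on the scalar guard
`1 ≤ n ∧ j′ = n+1`) and rows 89–92 discharge them verbatim; AT the pinned pair (B2″)/(B3″) are discharged by `klpp_scalarRow_direct/crossed_pinned_of_sizes`
(…BudgetScalarRowsPinned) against TWO new threshold rows (T2p) `A2s·(32855c₄² + 2²⁸4⁻ⁿe₄c₄) + (4/15367)·tD·Klam² ≤ (9/20)θrKlam²`, (T3p) `… 65709 …, tX`, and the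
CURED (B4″) — true-able now (five-slot forward entries + edge/tail slots; pricing CLASS5-RESOLVED-STEP.md §17) — stays the closer's ONE raw row at the pinned pair.
Plumbing; nothing about the model's sizes is asserted; nothing asserts (X).3, (c), K3 or superconductivity.  0 kit · 0 lit.
-/

noncomputable section

namespace Summit.HubbardSuperconductivity.HubbardSuperconductivity.Theorems.KLRegimeSplit

set_option linter.dupNamespace false -- summit = problem name (single-conjunct summit), D-0017

open Finset Matrix Set Literature.MathematicalPhysics.QuantumLattice Literature.Probability.LatticeModels GrassmannAlgebra
open Literature.MathematicalPhysics.QuantumLattice.FermiRG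
open Summit.HubbardSuperconductivity.HubbardSuperconductivity.Theorems.KLProgrammeCooperResummation
open Summit.HubbardSuperconductivity.HubbardSuperconductivity.Theorems.KLProgrammeLegKernels
open Summit.HubbardSuperconductivity.HubbardSuperconductivity.Theorems.TwoPointAssembly
open Summit.HubbardSuperconductivity.HubbardSuperconductivity.Theorems.DispersionFlow
open Summit.HubbardSuperconductivity.HubbardSuperconductivity.Theorems.KLRegimeWick
open Summit.HubbardSuperconductivity.HubbardSuperconductivity.Theorems.EngineV8

section ProducerSized

set_option maxHeartbeats 3200000 in -- long binder lists ×3 + the analytic bundle; four scalar-row lemmas per pair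
/-- **`pairTransferStep7_of_analytic_resolved_sized_pinned_all`** — «88b» pinned-pair twin (module docstring). -/
theorem pairTransferStep7_of_analytic_resolved_sized_pinned_all (C : ∀ L : ℕ, TorusSite 2 L → ℕ → Prop) (hC : ∀ (L : ℕ) (Qm : TorusSite 2 L) (j n : ℕ), j ≤ n → C L Qm n → C L Qm j) {P : SplitConsts} {R : RenConsts} {Q₀ : EngConsts} {G Gth : GeoConsts} {r θ : ℝ} {u : EngConsts → ℝ → ℝ} (mA : ℝ → ℝ) (hR : R.WF2) (hCF : 0 ≤ Gth.CF) (hKl : 0 ≤ P.Klam) (hr : 0 ≤ r) (hθ0 : 0 ≤ θ) (hθ : θ ≤ 1 / 5)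
    (h0 : ∀ (U μ β : ℝ), μ ∈ klWindowC → FrameOK R U (nScales β) μ 0) (hmA : ∀ (Q : EngConsts) (cc U : ℝ), 0 < U → U ≤ u Q cc → 0 ≤ mA U ∧ mA U * ((2 : ℝ) ^ 10 * 15367) ≤ 1 / 3) {A2s : ℝ} {u2s : RenConsts → ℝ} (h2s : TwoShellFrameAreaAt A2s u2s) (hA2s : 0 ≤ A2s)
    -- the conv lemmas' regime side conditions, asked IN THE LOOP'S CONTEXT («hkit»; the band condition only for `1 ≤ n`; `U ≤ u2s R` is the package threshold's to grant)
    (hkit : G.WF → ∀ Q : EngConsts, Q₀.IsRaiseOf Q → ∀ cc : ℝ, 0 < cc → cc ≤ klEngC₃6 P R → ∀ μ ∈ klWindowC, ∀ U : ℝ, 0 < U → U ≤ klEngU₀10 P R cc → U ≤ u Q cc → ∀ β : ℝ, klBetaMin ≤ β → β ≤ Real.exp (cc / U ^ 2) → ∀ (L M : ℕ) [NeZero L] [NeZero M], klEngL₄ P R β U ≤ L → klEngM₃ β U L ≤ M → ∀ n : ℕ, n + 1 ≤ nScales β + 1 → IsKLRegime U cc (-((n + 1 : ℕ) : ℤ))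 →
      U ≤ u2s R ∧ Real.pi / (4 * β) ≤ klScale klE0 (n + 1) ∧ (4 + 8 / 3 * R.Gfr 1 * U ^ 2) * (2 * Real.pi / L) ≤ klScale klE0 (n + 1) ∧ (1 ≤ n → 2 * klScale klE0 n + (4 + 8 / 3 * R.Gfr 1 * U ^ 2) * (2 * Real.pi / L) ≤ klE0)) (hbase : G.WF → ∀ Q : EngConsts, Q₀.IsRaiseOf Q → ∀ cc : ℝ, 0 < cc → cc ≤ klEngC₃6 P R → ∀ μ ∈ klWindowC, ∀ U : ℝ, 0 < U → U ≤ klEngU₀10 P R cc → U ≤ u Q cc →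
          ∀ β : ℝ, klBetaMin ≤ β → β ≤ Real.exp (cc / U ^ 2) → ∀ (L M : ℕ) [NeZero L] [NeZero M], klEngL₄ P R β U ≤ L → klEngM₃ β U L ≤ M → 0 ≤ nScales β + 1 → IsKLRegime U cc (-((0 : ℕ) : ℤ)) → HistP klPredsV17F2 L M G P Q R β U μ 0 0 → FrameOK R U (nScales β) μ (klFlowFrameU L M β U μ 0) → (∀ j ≤ 0, LevelsUExportMixedAt L M (klCU2 P R Q₀) P β U μ j) →
      ∀ j j' : ℕ, 0 ≤ j' → j' ≤ j → j ≤ nScales β + 1 → ∀ Qm : TorusSite 2 L, C L Qm 0 →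
      -- BASE CLOSED at scale 0 (k3c1-p1 g14 rows 52/52b `klmg_memberAmplitude_sub_le_sq` / `klmf_baseData_of_scaleZero`; regime rows from the thresholds): the two a priori rows
      -- [class #1] and ONE scalar inequality of the depth `j′` (`klTransferC R` = k3c2-p1 g5's closed scale-0 transfer constant)
      (∀ x y, ‖klMemberArrayF L M β U μ 0 (softSymbolCompl L M β μ (klFlowFrameU L M β U μ 0) 0 j) Qm x y‖ ≤ mA U) ∧ (∀ x y, ‖klMemberArrayF L M β U μ 0 (softSymbolCompl L M β μ (klFlowFrameU L M β U μ 0) 0 j') Qm x y‖ ≤ mA U) ∧ 4 / 6047 * klIdxMass 0 j' * (klTransferC R * U ^ 2) + 4 * (mA U * mA U) * klIdxMass 0 j' ≤ θ * (r * ((P.Klam * U) ^ 2 * klIdxMass 0 j'))) (hsucc : G.WF → ∀ Q : EngConsts, Q₀.IsRaiseOf Q →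
      ∀ cc : ℝ, 0 < cc → cc ≤ klEngC₃6 P R → ∀ μ ∈ klWindowC, ∀ U : ℝ, 0 < U → U ≤ klEngU₀10 P R cc → U ≤ u Q cc → ∀ β : ℝ, klBetaMin ≤ β → β ≤ Real.exp (cc / U ^ 2) → ∀ (L M : ℕ) [NeZero L] [NeZero M], klEngL₄ P R β U ≤ L → klEngM₃ β U L ≤ M → ∀ n : ℕ, n + 1 ≤ nScales β + 1 → IsKLRegime U cc (-((n + 1 : ℕ) : ℤ)) → HistP klPredsV17F2 L M G P Q R β U μ 0 (n + 1) →
                  FrameOK R U (nScales β) μ (klFlowFrameU L M β U μ (n + 1)) → (∀ j ≤ n + 1, LevelsUExportMixedAt L M (klCU2 P R Q₀) P β U μ j) → (∀ Λ ∈ Icc (klScale klE0 (n + 1)) (klScale klE0 n), hubbardEffPartitionFnCT L M β U μ 0 (klFlowFrameU L M β U μ (n + 1)) Λ ≠ 0) ∧ ∀ (A A' : ℕ → TorusSite 2 L → ℝ → Matrix (TorusSite 2 L) (TorusSite 2 L) ℂ) (b b' : ℕ → TorusSite 2 L → ℝ → TorusSite 2 L → ℂ)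
        (a : ℕ → ℕ → TorusSite 2 L → ℝ → TorusSite 2 L → ℂ) (ρ : ℕ → TorusSite 2 L → TorusSite 2 L → ℝ) (V : ℕ → ℝ → (Fin 4 → HubbardFieldIdx L M) → ℂ) (V6 : ℕ → ℝ → (Fin 6 → HubbardFieldIdx L M) → ℂ) (Sg : ℕ → ℝ → FreqMomentum L M → Fin 2 → ℂ) (Hd : ℕ → ℝ → (Fin 4 → HubbardFieldIdx L M) → ℂ) (Φ : ℕ → ℝ → FreqMomentum L M → ℝ) (Wd : ℝ →
                FreqMomentum L M → ℝ) (Br : ℕ → TorusSite 2 L → ℝ → TorusSite 2 L × MatsubaraIdx M → ℂ), (A = fun j Qm t => Matrix.of fun k k' : TorusSite 2 L => if k ∈ klBall L μ 0 ∧ k' ∈ klBall L μ 0 then vertexFn L M β (gaussConv ℂ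
        (softCovOf L M β μ (klFlowFrameU L M β U μ (n + 1)) (softSymbolCompl L M β μ (klFlowFrameU L M β U μ (n + 1)) (n + 1) j) + hubbardCovAboveCT L M β μ 0 (klFlowFrameU L M β U μ (n + 1)) (klScale klE0 (n + 1)) - hubbardCovAboveCT L M β μ 0 (klFlowFrameU L M β U μ (n + 1)) (klScale klE0 n + t * (klScale klE0 (n + 1) - klScale klE0 n)))
        (hubbardEffectiveActionCT L M β U μ 0 (klFlowFrameU L M β U μ (n + 1)) (klScale klE0 n + t * (klScale klE0 (n + 1) - klScale klE0 n)))) 4 ![(((omega0 M, k'), 0), 0), ((((omega0 M).rev, Qm - k'), 1), 0), ((((omega0 M).rev, Qm - k), 1), 1), (((omega0 M, k), 0), 1)] else 0) → (A' = fun j Qm t => Matrix.of fun k k' : TorusSite 2 L => if k ∈ klBall L μ 0 ∧ k' ∈ klBall L μ 0 then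
      (klScale klE0 (n + 1) - klScale klE0 n) • -((2 : ℂ)⁻¹ * vertexFn L M β (gaussConv ℂ (softCovOf L M β μ (klFlowFrameU L M β U μ (n + 1)) (softSymbolCompl L M β μ (klFlowFrameU L M β U μ (n + 1)) (n + 1) j) + hubbardCovAboveCT L M β μ 0 (klFlowFrameU L M β U μ (n + 1)) (klScale klE0 (n + 1)) -
          hubbardCovAboveCT L M β μ 0 (klFlowFrameU L M β U μ (n + 1)) (klScale klE0 n + t * (klScale klE0 (n + 1) - klScale klE0 n))) (grassmannDerivPairing ℂ (Matrix.of fun X Y : HubbardFieldIdx L M => deriv (fun Λ'' : ℝ => hubbardCovAboveCT L M β μ 0 (klFlowFrameU L M β U μ (n + 1)) Λ'' X Y) (klScale klE0 n + t * (klScale klE0 (n + 1) - klScale klE0 n)))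
          (hubbardEffectiveActionCT L M β U μ 0 (klFlowFrameU L M β U μ (n + 1)) (klScale klE0 n + t * (klScale klE0 (n + 1) - klScale klE0 n))) (hubbardEffectiveActionCT L M β U μ 0 (klFlowFrameU L M β U μ (n + 1)) (klScale klE0 n + t * (klScale klE0 (n + 1) - klScale klE0 n))))) 4 ![(((omega0 M, k'), 0), 0), ((((omega0 M).rev, Qm - k'), 1), 0), ((((omega0 M).rev, Qm - k), 1), 1), (((omega0 M, k), 0), 1)]) else 0) →
        (b = fun j Qm t p => -((klBubbleMass L M β μ (klFlowFrameU L M β U μ (n + 1)) (fun k => (softSymbolCompl L M β μ (klFlowFrameU L M β U μ (n + 1)) (n + 1) j) k + (hubbardCutoffWeightCT L M β μ (klFlowFrameU L M β U μ (n + 1)) (klScale klE0 (n + 1)) k - hubbardCutoffWeightCT L M β μ (klFlowFrameU L M β U μ (n + 1)) (klScale klE0 n + t * (klScale klE0 (n + 1) - klScale klE0 n)) k))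
        (fun k => (softSymbolCompl L M β μ (klFlowFrameU L M β U μ (n + 1)) (n + 1) j) k + (hubbardCutoffWeightCT L M β μ (klFlowFrameU L M β U μ (n + 1)) (klScale klE0 (n + 1)) k - hubbardCutoffWeightCT L M β μ (klFlowFrameU L M β U μ (n + 1)) (klScale klE0 n + t * (klScale klE0 (n + 1) - klScale klE0 n)) k)) Qm p : ℝ) : ℂ)) → (b' = fun j Qm t p => (((klScale klE0 (n + 1) - klScale klE0 n) *
        (klBubbleMass L M β μ (klFlowFrameU L M β U μ (n + 1)) (fun k => deriv (fun Λ' => hubbardCutoffWeightCT L M β μ (klFlowFrameU L M β U μ (n + 1)) Λ' k) (klScale klE0 n + t * (klScale klE0 (n + 1) - klScale klE0 n))) (fun k => (softSymbolCompl L M β μ (klFlowFrameU L M β U μ (n + 1)) (n + 1) j) k + (hubbardCutoffWeightCT L M β μ (klFlowFrameU L M β U μ (n + 1)) (klScale klE0 (n + 1)) k -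
          hubbardCutoffWeightCT L M β μ (klFlowFrameU L M β U μ (n + 1)) (klScale klE0 n + t * (klScale klE0 (n + 1) - klScale klE0 n)) k)) Qm p + klBubbleMass L M β μ (klFlowFrameU L M β U μ (n + 1)) (fun k => (softSymbolCompl L M β μ (klFlowFrameU L M β U μ (n + 1)) (n + 1) j) k + (hubbardCutoffWeightCT L M β μ (klFlowFrameU L M β U μ (n + 1)) (klScale klE0 (n + 1)) k -
          hubbardCutoffWeightCT L M β μ (klFlowFrameU L M β U μ (n + 1)) (klScale klE0 n + t * (klScale klE0 (n + 1) - klScale klE0 n)) k)) (fun k => deriv (fun Λ' => hubbardCutoffWeightCT L M β μ (klFlowFrameU L M β U μ (n + 1)) Λ' k) (klScale klE0 n + t * (klScale klE0 (n + 1) - klScale klE0 n))) Qm p) : ℝ) : ℂ)) → (a = fun j j' Qm t p => (b j Qm t p - b j' Qm t p) +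
      (-(((klTransferWeight L M β μ (klFlowFrameU L M β U μ (n + 1)) (n + 1) (softSymbolCompl L M β μ (klFlowFrameU L M β U μ (n + 1)) (n + 1) j) Qm p - klTransferWeight L M β μ (klFlowFrameU L M β U μ (n + 1)) (n + 1) (softSymbolCompl L M β μ (klFlowFrameU L M β U μ (n + 1)) (n + 1) j') Qm p : ℝ)) : ℂ) - (b j Qm 1 p - b j' Qm 1 p))) →
        (ρ = fun j Qm c => klRungProfile L M β μ (klFlowFrameU L M β U μ (n + 1)) n (softSymbolCompl L M β μ (klFlowFrameU L M β U μ (n + 1)) (n + 1) j) Qm c) → (V = fun j t X => vertexFn L M β (gaussConv ℂ (softCovOf L M β μ (klFlowFrameU L M β U μ (n + 1)) (softSymbolCompl L M β μ (klFlowFrameU L M β U μ (n + 1)) (n + 1) j) + hubbardCovAboveCT L M β μ 0 (klFlowFrameU L M β U μ (n + 1)) (klScale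
                klE0 (n + 1)) - hubbardCovAboveCT L M β μ 0 (klFlowFrameU L M β U μ (n + 1)) (klScale klE0 n + t * (klScale klE0 (n + 1) - klScale klE0 n))) (hubbardEffectiveActionCT L M β U μ 0 (klFlowFrameU L M β U μ (n + 1)) (klScale klE0 n + t * (klScale klE0 (n + 1) - klScale klE0 n)))) 4 X) →
        (V6 = fun j t X => vertexFn L M β (gaussConv ℂ (softCovOf L M β μ (klFlowFrameU L M β U μ (n + 1)) (softSymbolCompl L M β μ (klFlowFrameU L M β U μ (n + 1)) (n + 1) j) + hubbardCovAboveCT L M β μ 0 (klFlowFrameU L M β U μ (n + 1)) (klScale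
                klE0 (n + 1)) - hubbardCovAboveCT L M β μ 0 (klFlowFrameU L M β U μ (n + 1)) (klScale klE0 n + t * (klScale klE0 (n + 1) - klScale klE0 n))) (hubbardEffectiveActionCT L M β U μ 0 (klFlowFrameU L M β U μ (n + 1)) (klScale klE0 n + t * (klScale klE0 (n + 1) - klScale klE0 n)))) 6 X) →
        (Sg = fun j t p σ => selfEnergy L M β (gaussConv ℂ (softCovOf L M β μ (klFlowFrameU L M β U μ (n + 1)) (softSymbolCompl L M β μ (klFlowFrameU L M β U μ (n + 1)) (n + 1) j) + hubbardCovAboveCT L M β μ 0 (klFlowFrameU L M β U μ (n + 1))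
                (klScale klE0 (n + 1)) - hubbardCovAboveCT L M β μ 0 (klFlowFrameU L M β U μ (n + 1)) (klScale klE0 n + t * (klScale klE0 (n + 1) - klScale klE0 n))) (hubbardEffectiveActionCT L M β U μ 0 (klFlowFrameU L M β U μ (n + 1)) (klScale klE0 n + t * (klScale klE0 (n + 1) - klScale klE0 n)))) p σ) →
        (Hd = fun j t X => vertexFn L M β (dblFold ℂ (grassmannLaplacian ℂ (crossCov ℂ (Matrix.of fun X Y : HubbardFieldIdx L M => deriv (fun Λ' : ℝ => hubbardCovAboveCT L M β μ 0 (klFlowFrameU L M β U μ (n + 1)) Λ' X Y) (klScale klE0 n + t *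
                (klScale klE0 (n + 1) - klScale klE0 n)))) ((gaussConv ℂ (crossCov ℂ (softCovOf L M β μ (klFlowFrameU L M β U μ (n + 1)) (softSymbolCompl L M β μ (klFlowFrameU L M β U μ (n + 1)) (n + 1) j) + hubbardCovAboveCT L M β μ 0 (klFlowFrameU
                L M β U μ (n + 1)) (klScale klE0 (n + 1)) - hubbardCovAboveCT L M β μ 0 (klFlowFrameU L M β U μ (n + 1)) (klScale klE0 n + t * (klScale klE0 (n + 1) - klScale klE0 n)))) - grassmannLaplacian ℂ (crossCov ℂ (softCovOf L M β μ
                (klFlowFrameU L M β U μ (n + 1)) (softSymbolCompl L M β μ (klFlowFrameU L M β U μ (n + 1)) (n + 1) j) + hubbardCovAboveCT L M β μ 0 (klFlowFrameU L M β U μ (n + 1)) (klScale klE0 (n + 1)) - hubbardCovAboveCT L M β μ 0 (klFlowFrameU L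
                M β U μ (n + 1)) (klScale klE0 n + t * (klScale klE0 (n + 1) - klScale klE0 n))))) (dblCopy ℂ 0 (gaussConv ℂ (softCovOf L M β μ (klFlowFrameU L M β U μ (n + 1)) (softSymbolCompl L M β μ (klFlowFrameU L M β U μ (n + 1)) (n + 1) j) +
                hubbardCovAboveCT L M β μ 0 (klFlowFrameU L M β U μ (n + 1)) (klScale klE0 (n + 1)) - hubbardCovAboveCT L M β μ 0 (klFlowFrameU L M β U μ (n + 1)) (klScale klE0 n + t * (klScale klE0 (n + 1) - klScale klE0 n)))
                (hubbardEffectiveActionCT L M β U μ 0 (klFlowFrameU L M β U μ (n + 1)) (klScale klE0 n + t * (klScale klE0 (n + 1) - klScale klE0 n)))) * dblCopy ℂ 1 (gaussConv ℂ (softCovOf L M β μ (klFlowFrameU L M β U μ (n + 1)) (softSymbolCompl L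
                M β μ (klFlowFrameU L M β U μ (n + 1)) (n + 1) j) + hubbardCovAboveCT L M β μ 0 (klFlowFrameU L M β U μ (n + 1)) (klScale klE0 (n + 1)) - hubbardCovAboveCT L M β μ 0 (klFlowFrameU L M β U μ (n + 1)) (klScale klE0 n + t * (klScale
                klE0 (n + 1) - klScale klE0 n))) (hubbardEffectiveActionCT L M β U μ 0 (klFlowFrameU L M β U μ (n + 1)) (klScale klE0 n + t * (klScale klE0 (n + 1) - klScale klE0 n)))))))) 4 X) →
        (Φ = fun j t k => (softSymbolCompl L M β μ (klFlowFrameU L M β U μ (n + 1)) (n + 1) j) k + (hubbardCutoffWeightCT L M β μ (klFlowFrameU L M β U μ (n + 1)) (klScale klE0 (n + 1)) k - hubbardCutoffWeightCT L M β μ (klFlowFrameU L M β U μ (n + 1)) (klScale klE0 n + t * (klScale klE0 (n + 1) - klScale klE0 n)) k)) →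
        (Wd = fun t k => deriv (fun Λ' : ℝ => hubbardCutoffWeightCT L M β μ (klFlowFrameU L M β U μ (n + 1)) Λ' k) (klScale klE0 n + t * (klScale klE0 (n + 1) - klScale klE0 n))) → (Br = fun j Qm t z => -(((((β * (L : ℝ) ^ 2 : ℝ) : ℂ)))⁻¹ * propCT L M β μ (klFlowFrameU L M β U μ (n + 1)) (z.2, z.1) * propCT L M β μ (klFlowFrameU L M β U μ (n + 1)) (z.2.rev, Qm - z.1)) *
      ((((klScale klE0 (n + 1) - klScale klE0 n) * (-Wd t (z.2, z.1) * Φ j t (z.2.rev, Qm - z.1) - Φ j t (z.2, z.1) * Wd t (z.2.rev, Qm - z.1))) : ℝ) : ℂ)) → ∀ j j' : ℕ, n + 1 ≤ j' → j' ≤ j → j ≤ nScales β + 1 → ∀ Qm : TorusSite 2 L, C L Qm (n + 1) → ∃ (ηr η₁ η₂ R₀ Φ : TorusSite 2 L → TorusSite 2 L → ℝ) (d : TorusSite 2 L → ℝ) (M4 M6 M2 η4 η6 η2 c₄ c₆ c₂ e₄ e₆ e₂ sₑ zD hD wD lD tD zX hX wX lX tX : ℝ)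
        (RH₁ RH₂ Rhd RL₁ RL₂ Rl₁ Rl₂ : TorusSite 2 L → TorusSite 2 L → ℝ) (Ng : ℕ → ℝ), (∀ t ∈ Icc (0 : ℝ) 1, ∀ x y, ‖A j Qm t x y‖ ≤ mA U) ∧ (∀ t ∈ Icc (0 : ℝ) 1, ∀ x y, ‖A j' Qm t x y‖ ≤ mA U) ∧
        -- class-#1 kernel inputs IN GRID-NORMS CURRENCY (rows 48/51): the pinned GRID kernel norms `Ng` of `Gg(t) = effAction (SᵀC^K_(Λ(t))S)(V_N + 𝒩_(K,N))` and the six binomial numbers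
        -- they produce (γ := √6047, κD := √(Λ_(n+1)·klIdxMass (n+1) j′) discharged); `M4 M6 M2 η4 η6 η2` are the names the `Ran` row uses
        (∀ m', 0 ≤ Ng m') ∧ (0 ≤ zD ∧ 0 ≤ hD ∧ 0 ≤ wD ∧ 0 ≤ lD ∧ 0 ≤ tD ∧ 0 ≤ zX ∧ 0 ≤ hX ∧ 0 ≤ wX ∧ 0 ≤ lX ∧ 0 ≤ tX) ∧
        -- «88b» THE PINNED PAIR (`1 ≤ n`, `j′ = n+1`): the SIGNED direct/crossed `D`-rows in the forward windows, five-slot scalar form (binders `zD … tX`; split3 door ∘ slots)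
        (1 ≤ n → j' = n + 1 → ∀ t ∈ Icc (0 : ℝ) 1, ∀ x y : TorusSite 2 L, (4 + 8 / 3 * R.Gfr 1 * U ^ 2) * klTorusNorm L (x - y) < klScale klE0 (n + 1) / 8 → ((klScale klE0 n - klScale klE0 (n + 1)) * ((β * (L : ℝ) ^ 2) ^ 3)⁻¹) * ‖(∑ p : FreqMomentum L M, ∑ σ : Fin 2, ∑ p' : FreqMomentum L M, if matsubaraInt M p'.1 + matsubaraInt M (omega0 M) = matsubaraInt M p.1 + matsubaraInt M (omega0 M) ∧ p'.2 = p.2 + x - y then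
              ((((((((softSymbolCompl L M β μ (klFlowFrameU L M β U μ (n + 1)) (n + 1) j) p - (softSymbolCompl L M β μ (klFlowFrameU L M β U μ (n + 1)) (n + 1) j') p)) : ℝ) : ℂ) * (((β * (L : ℝ) ^ 2 : ℝ) : ℂ) * propCT L M β μ (klFlowFrameU L M β U μ (n + 1)) p)) * ((((Wd t p') : ℝ) : ℂ) * (((β * (L : ℝ) ^ 2 : ℝ) : ℂ) * propCT L M β μ
                      (klFlowFrameU L M β U μ (n + 1)) p'))) + (((((Wd t p) : ℝ) : ℂ) * (((β * (L : ℝ) ^ 2 : ℝ) : ℂ) * propCT L M β μ (klFlowFrameU L M β U μ (n + 1)) p)) * ((((((softSymbolCompl L M β μ (klFlowFrameU L M β U μ (n + 1)) (n + 1) j) p' - (softSymbolCompl L M β μ (klFlowFrameU L M β U μ (n + 1)) (n + 1) j') p')) : ℝ) :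
                      ℂ) * (((β * (L : ℝ) ^ 2 : ℝ) : ℂ) * propCT L M β μ (klFlowFrameU L M β U μ (n + 1)) p')))) * (V j t ![((p, σ), 1), ((p', σ), 0), (((omega0 M, y), 0), 0), (((omega0 M, x), 0), 1)] * V j t ![((p, σ), 0), ((p', σ), 1), ((((omega0 M).rev, Qm - y), 1), 0), ((((omega0 M).rev, Qm - x), 1), 1)]) else 0)‖ ≤
          (P.Klam * U) ^ 2 * (zD * ((4 : ℝ) ^ (n + 1))⁻¹ + hD * ((4 : ℝ) ^ (nScales β - n))⁻¹ + wD * ((2 : ℝ) ^ n)⁻¹ + lD * ((L : ℝ))⁻¹ + tD * min (klTorusNorm L (x - y) / klScale klE0 (n + 1)) (klScale klE0 (n + 1) / klTorusNorm L (x - y)))) ∧ (1 ≤ n → j' = n + 1 → n + 3 ≤ nScales β → ∀ t ∈ Icc (0 : ℝ) 1, ∀ x y : TorusSite 2 L, (4 + 8 / 3 * R.Gfr 1 * U ^ 2) * klTorusNorm L (x + y - Qm) < klScale klE0 (n + 1) / 16 →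
          ((klScale klE0 n - klScale klE0 (n + 1)) * ((β * (L : ℝ) ^ 2) ^ 3)⁻¹) * ‖(∑ p : FreqMomentum L M, ∑ p' : FreqMomentum L M, if matsubaraInt M p'.1 + matsubaraInt M (omega0 M) + matsubaraInt M (omega0 M) + 1 = matsubaraInt M p.1 ∧ p'.2 = p.2 + Qm - x - y then
              ((((((((softSymbolCompl L M β μ (klFlowFrameU L M β U μ (n + 1)) (n + 1) j) p - (softSymbolCompl L M β μ (klFlowFrameU L M β U μ (n + 1)) (n + 1) j') p)) : ℝ) : ℂ) * (((β * (L : ℝ) ^ 2 : ℝ) : ℂ) * propCT L M β μ (klFlowFrameU L M β U μ (n + 1)) p)) * ((((Wd t p') : ℝ) : ℂ) * (((β * (L : ℝ) ^ 2 : ℝ) : ℂ) * propCT L M β μ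
                      (klFlowFrameU L M β U μ (n + 1)) p'))) + (((((Wd t p) : ℝ) : ℂ) * (((β * (L : ℝ) ^ 2 : ℝ) : ℂ) * propCT L M β μ (klFlowFrameU L M β U μ (n + 1)) p)) * ((((((softSymbolCompl L M β μ (klFlowFrameU L M β U μ (n + 1)) (n + 1) j) p' - (softSymbolCompl L M β μ (klFlowFrameU L M β U μ (n + 1)) (n + 1) j') p')) : ℝ) :
                      ℂ) * (((β * (L : ℝ) ^ 2 : ℝ) : ℂ) * propCT L M β μ (klFlowFrameU L M β U μ (n + 1)) p')))) * (V j t ![((p, 0), 1), ((p', 1), 0), (((omega0 M, y), 0), 0), ((((omega0 M).rev, Qm - x), 1), 1)] * V j t ![((p, 0), 0), ((p', 1), 1), ((((omega0 M).rev, Qm - y), 1), 0), (((omega0 M, x), 0), 1)]) else 0)‖ ≤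
          (P.Klam * U) ^ 2 * (zX * ((4 : ℝ) ^ (n + 1))⁻¹ + hX * ((4 : ℝ) ^ (nScales β - n))⁻¹ + wX * ((2 : ℝ) ^ n)⁻¹ + lX * ((L : ℝ))⁻¹ + tX * min (klTorusNorm L (x + y - Qm) / klScale klE0 (n + 1)) (klScale klE0 (n + 1) / klTorusNorm L (x + y - Qm)))) ∧ (∀ t ∈ Icc (0 : ℝ) 1, ∀ m' (i : Fin (2 * m')) (w : GridLeg (GridPoint L (2 * (2 * M)))),
          ∑ Y ∈ univ.filter (fun Y : Fin (2 * m') → GridLeg (GridPoint L (2 * (2 * M))) => Y i = w), ‖kernel ℂ (effAction ℂ ((hubbardGridSub L M β (2 * (2 * M))).transpose * hubbardCovAboveCT L M β μ 0 (klFlowFrameU L M β U μ (n + 1)) (klScale klE0 n + t * (klScale klE0 (n + 1) - klScale klE0 n)) * hubbardGridSub L M β (2 * (2 * M)))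
              (hubbardGridInteraction L (2 * (2 * M)) β U + hubbardGridCounterQuadratic L (2 * (2 * M)) β (klFlowFrameU L M β U μ (n + 1)))) (2 * m') Y‖ ≤ Ng m') ∧ (((2 * 2).factorial : ℝ) / (β * (L : ℝ) ^ 2) * (Fintype.card (GridLeg (GridPoint L (2 * (2 * M)))) *
          ∑ m' ∈ range (Fintype.card (GridLeg (GridPoint L (2 * (2 * M)))) / 2 + 1), if 2 ≤ m' then ((2 * m').choose (2 * 2) : ℝ) * Real.sqrt 6047 ^ (2 * m' - 2 * 2) * Ng m' else 0) ≤ M4) ∧ (((2 * 3).factorial : ℝ) / (β * (L : ℝ) ^ 2) * (Fintype.card (GridLeg (GridPoint L (2 * (2 * M)))) *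
          ∑ m' ∈ range (Fintype.card (GridLeg (GridPoint L (2 * (2 * M)))) / 2 + 1), if 3 ≤ m' then ((2 * m').choose (2 * 3) : ℝ) * Real.sqrt 6047 ^ (2 * m' - 2 * 3) * Ng m' else 0) ≤ M6) ∧ (((2 * 1).factorial : ℝ) / (β * (L : ℝ) ^ 2) * (Fintype.card (GridLeg (GridPoint L (2 * (2 * M)))) *
          ∑ m' ∈ range (Fintype.card (GridLeg (GridPoint L (2 * (2 * M)))) / 2 + 1), if 1 ≤ m' then ((2 * m').choose (2 * 1) : ℝ) * Real.sqrt 6047 ^ (2 * m' - 2 * 1) * Ng m' else 0) ≤ M2) ∧ (((2 * 2).factorial : ℝ) / (β * (L : ℝ) ^ 2) * (Fintype.card (GridLeg (GridPoint L (2 * (2 * M)))) *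
          ∑ m' ∈ range (Fintype.card (GridLeg (GridPoint L (2 * (2 * M)))) / 2 + 1), if 2 < m' then ((2 * m').choose (2 * 2) : ℝ) * Real.sqrt (klScale klE0 (n + 1) * klIdxMass (n + 1) j') ^ (2 * m' - 2 * 2) * (∑ m'' ∈ range (Fintype.card (GridLeg (GridPoint L (2 * (2 * M)))) / 2 + 1), if m' ≤ m'' then ((2 * m'').choose (2 * m') : ℝ) * Real.sqrt 6047 ^ (2 * m'' - 2 * m') * Ng m'' else 0) else 0) ≤ η4) ∧
        (((2 * 3).factorial : ℝ) / (β * (L : ℝ) ^ 2) * (Fintype.card (GridLeg (GridPoint L (2 * (2 * M)))) *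
          ∑ m' ∈ range (Fintype.card (GridLeg (GridPoint L (2 * (2 * M)))) / 2 + 1), if 3 < m' then ((2 * m').choose (2 * 3) : ℝ) * Real.sqrt (klScale klE0 (n + 1) * klIdxMass (n + 1) j') ^ (2 * m' - 2 * 3) * (∑ m'' ∈ range (Fintype.card (GridLeg (GridPoint L (2 * (2 * M)))) / 2 + 1), if m' ≤ m'' then ((2 * m'').choose (2 * m') : ℝ) * Real.sqrt 6047 ^ (2 * m'' - 2 * m') * Ng m'' else 0) else 0) ≤ η6) ∧
        (((2 * 1).factorial : ℝ) / (β * (L : ℝ) ^ 2) * (Fintype.card (GridLeg (GridPoint L (2 * (2 * M)))) *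
          ∑ m' ∈ range (Fintype.card (GridLeg (GridPoint L (2 * (2 * M)))) / 2 + 1), if 1 < m' then ((2 * m').choose (2 * 1) : ℝ) * Real.sqrt (klScale klE0 (n + 1) * klIdxMass (n + 1) j') ^ (2 * m' - 2 * 1) * (∑ m'' ∈ range (Fintype.card (GridLeg (GridPoint L (2 * (2 * M)))) / 2 + 1), if m' ≤ m'' then ((2 * m'').choose (2 * m') : ℝ) * Real.sqrt 6047 ^ (2 * m'' - 2 * m') * Ng m'' else 0) else 0) ≤ η2) ∧
        -- SIZE ROWS (cell STATUS (R253) size model; k3c1-p1 g16 rows 89–92): the kernel numbers in units of `U` / the D-line Gram currency `κD² = Λₙ₊₁·klIdxMass (n+1) j′`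
        0 ≤ M4 ∧ 0 ≤ M6 ∧ 0 ≤ M2 ∧ 0 ≤ η4 ∧ 0 ≤ η6 ∧ 0 ≤ η2 ∧ 0 ≤ c₄ ∧ 0 ≤ c₆ ∧ 0 ≤ c₂ ∧ 0 ≤ e₄ ∧ 0 ≤ e₆ ∧ 0 ≤ e₂ ∧ 0 ≤ sₑ ∧ M4 ≤ c₄ * U ∧ M6 ≤ c₆ * U ∧ M2 ≤ c₂ * U ∧ η4 ≤ e₄ * U * (klScale klE0 (n + 1) * klIdxMass (n + 1) j') ∧ η6 ≤ e₆ * U * (klScale klE0 (n + 1) * klIdxMass (n + 1) j') ∧ η2 ≤ e₂ * U * (klScale klE0 (n + 1) * klIdxMass (n + 1) j') ∧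
        (∀ t ∈ Icc (0 : ℝ) 1, ∀ x y : TorusSite 2 L, ‖Hd j t ![(((omega0 M, y), 0), 0), ((((omega0 M).rev, Qm - y), 1), 0), ((((omega0 M).rev, Qm - x), 1), 1), (((omega0 M, x), 0), 1)]‖ ≤ RH₁ x y) ∧ (∀ t ∈ Icc (0 : ℝ) 1, ∀ x y : TorusSite 2 L, ‖Hd j' t ![(((omega0 M, y), 0), 0), ((((omega0 M).rev, Qm - y), 1), 0), ((((omega0 M).rev, Qm - x), 1), 1), (((omega0 M, x), 0), 1)]‖ ≤ RH₂ x y) ∧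
        (∀ t ∈ Icc (0 : ℝ) 1, ∀ x y : TorusSite 2 L, ‖Hd j t ![(((omega0 M, y), 0), 0), ((((omega0 M).rev, Qm - y), 1), 0), ((((omega0 M).rev, Qm - x), 1), 1), (((omega0 M, x), 0), 1)] - Hd j' t ![(((omega0 M, y), 0), 0), ((((omega0 M).rev, Qm - y), 1), 0), ((((omega0 M).rev, Qm - x), 1), 1), (((omega0 M, x), 0), 1)]‖ ≤ Rhd x y) ∧
        (∀ t ∈ Icc (0 : ℝ) 1, ∀ x y : TorusSite 2 L, ‖∑ z : TorusSite 2 L × MatsubaraIdx M, Br j Qm t z * ((if z.1 ∈ klBall L μ 0 then V j t ![(((omega0 M, z.1), 0), 0), ((((omega0 M).rev, Qm - z.1), 1), 0), ((((omega0 M).rev, Qm - x), 1), 1), (((omega0 M, x), 0), 1)] * V j t ![(((omega0 M, y), 0), 0), ((((omega0 M).rev, Qm - y), 1), 0), ((((omega0 M).rev, Qm - z.1), 1), 1), (((omega0 M, z.1), 0), 1)] else 0) -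
            V j t ![(((z.2, z.1), 0), 0), (((z.2.rev, Qm - z.1), 1), 0), ((((omega0 M).rev, Qm - x), 1), 1), (((omega0 M, x), 0), 1)] * V j t ![(((omega0 M, y), 0), 0), ((((omega0 M).rev, Qm - y), 1), 0), (((z.2.rev, Qm - z.1), 1), 1), (((z.2, z.1), 0), 1)])‖ ≤ RL₁ x y) ∧ (∀ t ∈ Icc (0 : ℝ) 1, ∀ x y : TorusSite 2 L, ‖∑ z : TorusSite 2 L × MatsubaraIdx M, Br j' Qm t z * ((if z.1 ∈ klBall L μ 0 then
              V j' t ![(((omega0 M, z.1), 0), 0), ((((omega0 M).rev, Qm - z.1), 1), 0), ((((omega0 M).rev, Qm - x), 1), 1), (((omega0 M, x), 0), 1)] * V j' t ![(((omega0 M, y), 0), 0), ((((omega0 M).rev, Qm - y), 1), 0), ((((omega0 M).rev, Qm - z.1), 1), 1), (((omega0 M, z.1), 0), 1)] else 0) - V j' t ![(((z.2, z.1), 0), 0), (((z.2.rev, Qm - z.1), 1), 0), ((((omega0 M).rev, Qm - x), 1), 1), (((omega0 M, x), 0), 1)] *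
              V j' t ![(((omega0 M, y), 0), 0), ((((omega0 M).rev, Qm - y), 1), 0), (((z.2.rev, Qm - z.1), 1), 1), (((z.2, z.1), 0), 1)])‖ ≤ RL₂ x y) ∧ (∀ t ∈ Icc (0 : ℝ) 1, ∀ x y : TorusSite 2 L, ‖∑ z : TorusSite 2 L × MatsubaraIdx M, (fun z : TorusSite 2 L × MatsubaraIdx M => -(((((β * (L : ℝ) ^ 2 : ℝ) : ℂ)))⁻¹ * propCT L M β μ (klFlowFrameU L M β U μ (n + 1)) (z.2, z.1) * propCT L M β μ
                (klFlowFrameU L M β U μ (n + 1)) (z.2.rev, Qm - z.1)) * ((((klScale klE0 (n + 1) - klScale klE0 n) * (-Wd t (z.2, z.1) * ((softSymbolCompl L M β μ (klFlowFrameU L M β U μ (n + 1)) (n + 1) j) (z.2.rev, Qm - z.1) - (softSymbolCompl L M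
                β μ (klFlowFrameU L M β U μ (n + 1)) (n + 1) j') (z.2.rev, Qm - z.1)) - ((softSymbolCompl L M β μ (klFlowFrameU L M β U μ (n + 1)) (n + 1) j) (z.2, z.1) - (softSymbolCompl L M β μ (klFlowFrameU L M β U μ (n + 1)) (n + 1) j') (z.2, z.1)) * Wd t (z.2.rev, Qm - z.1))) : ℝ) : ℂ)) z * ((if z.1 ∈ klBall L μ 0 then
              V j t ![(((omega0 M, z.1), 0), 0), ((((omega0 M).rev, Qm - z.1), 1), 0), ((((omega0 M).rev, Qm - x), 1), 1), (((omega0 M, x), 0), 1)] * V j t ![(((omega0 M, y), 0), 0), ((((omega0 M).rev, Qm - y), 1), 0), ((((omega0 M).rev, Qm - z.1), 1), 1), (((omega0 M, z.1), 0), 1)] else 0) - V j t ![(((z.2, z.1), 0), 0), (((z.2.rev, Qm - z.1), 1), 0), ((((omega0 M).rev, Qm - x), 1), 1), (((omega0 M, x), 0), 1)] *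
              V j t ![(((omega0 M, y), 0), 0), ((((omega0 M).rev, Qm - y), 1), 0), (((z.2.rev, Qm - z.1), 1), 1), (((z.2, z.1), 0), 1)])‖ ≤ Rl₁ x y) ∧ (∀ t ∈ Icc (0 : ℝ) 1, ∀ x y : TorusSite 2 L, ‖∑ z : TorusSite 2 L × MatsubaraIdx M, Br j' Qm t z * (((if z.1 ∈ klBall L μ 0 then V j t ![(((omega0 M, z.1), 0), 0), ((((omega0 M).rev, Qm - z.1), 1), 0), ((((omega0 M).rev, Qm - x), 1), 1), (((omega0 M, x), 0), 1)] *
                V j t ![(((omega0 M, y), 0), 0), ((((omega0 M).rev, Qm - y), 1), 0), ((((omega0 M).rev, Qm - z.1), 1), 1), (((omega0 M, z.1), 0), 1)] else 0) - V j t ![(((z.2, z.1), 0), 0), (((z.2.rev, Qm - z.1), 1), 0), ((((omega0 M).rev, Qm - x), 1), 1), (((omega0 M, x), 0), 1)] * V j t ![(((omega0 M, y), 0), 0), ((((omega0 M).rev, Qm - y), 1), 0), (((z.2.rev, Qm - z.1), 1), 1), (((z.2, z.1), 0), 1)]) -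
            ((if z.1 ∈ klBall L μ 0 then V j' t ![(((omega0 M, z.1), 0), 0), ((((omega0 M).rev, Qm - z.1), 1), 0), ((((omega0 M).rev, Qm - x), 1), 1), (((omega0 M, x), 0), 1)] * V j' t ![(((omega0 M, y), 0), 0), ((((omega0 M).rev, Qm - y), 1), 0), ((((omega0 M).rev, Qm - z.1), 1), 1), (((omega0 M, z.1), 0), 1)] else 0) -
            V j' t ![(((z.2, z.1), 0), 0), (((z.2.rev, Qm - z.1), 1), 0), ((((omega0 M).rev, Qm - x), 1), 1), (((omega0 M, x), 0), 1)] * V j' t ![(((omega0 M, y), 0), 0), ((((omega0 M).rev, Qm - y), 1), 0), (((z.2.rev, Qm - z.1), 1), 1), (((z.2, z.1), 0), 1)]))‖ ≤ Rl₂ x y) ∧ (∀ x y, ‖klMemberArrayF L M β U μ n (softSymbolCompl L M β μ (klFlowFrameU L M β U μ n) n j) Qm x y‖ ≤ mA U) ∧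
        -- (F)(i) [k3c2-p2]: majorants of the FRAME SHIFT `K_n → K_(n+1)` of the history members / relative weight (model objects)
        (∀ x y, ‖(((Matrix.of fun k k' : TorusSite 2 L => if k ∈ klBall L μ 0 ∧ k' ∈ klBall L μ 0 then klCovSmearedPairAmplitude L M β U μ (klFlowFrameU L M β U μ (n + 1)) n (softCovOf L M β μ (klFlowFrameU L M β U μ (n + 1)) (softSymbolCompl L M β μ (klFlowFrameU L M β U μ (n + 1)) n j)) Qm k k' else 0) - klMemberArrayF L M β U μ n (softSymbolCompl L M β μ (klFlowFrameU L M β U μ n) n j) Qm) -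
          ((Matrix.of fun k k' : TorusSite 2 L => if k ∈ klBall L μ 0 ∧ k' ∈ klBall L μ 0 then klCovSmearedPairAmplitude L M β U μ (klFlowFrameU L M β U μ (n + 1)) n (softCovOf L M β μ (klFlowFrameU L M β U μ (n + 1)) (softSymbolCompl L M β μ (klFlowFrameU L M β U μ (n + 1)) n j')) Qm k k' else 0) - klMemberArrayF L M β U μ n (softSymbolCompl L M β μ (klFlowFrameU L M β U μ n) n j') Qm)) x y‖ ≤ ηr x y) ∧
        (∀ x y, ‖((Matrix.of fun k k' : TorusSite 2 L => if k ∈ klBall L μ 0 ∧ k' ∈ klBall L μ 0 then klCovSmearedPairAmplitude L M β U μ (klFlowFrameU L M β U μ (n + 1)) n (softCovOf L M β μ (klFlowFrameU L M β U μ (n + 1)) (softSymbolCompl L M β μ (klFlowFrameU L M β U μ (n + 1)) n j)) Qm k k' else 0) - klMemberArrayF L M β U μ n (softSymbolCompl L M β μ (klFlowFrameU L M β U μ n) n j) Qm) x y‖ ≤ η₁ x y) ∧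
        (∀ x y, ‖((Matrix.of fun k k' : TorusSite 2 L => if k ∈ klBall L μ 0 ∧ k' ∈ klBall L μ 0 then klCovSmearedPairAmplitude L M β U μ (klFlowFrameU L M β U μ (n + 1)) n (softCovOf L M β μ (klFlowFrameU L M β U μ (n + 1)) (softSymbolCompl L M β μ (klFlowFrameU L M β U μ (n + 1)) n j')) Qm k k' else 0) - klMemberArrayF L M β U μ n (softSymbolCompl L M β μ (klFlowFrameU L M β U μ n) n j') Qm) x y‖ ≤ η₂ x y) ∧
        (∀ c, ‖(fun p => -(((klTransferWeight L M β μ (klFlowFrameU L M β U μ (n + 1)) n (softSymbolCompl L M β μ (klFlowFrameU L M β U μ (n + 1)) n j) Qm p - klTransferWeight L M β μ (klFlowFrameU L M β U μ (n + 1)) n (softSymbolCompl L M β μ (klFlowFrameU L M β U μ (n + 1)) n j') Qm p : ℝ)) : ℂ)) c -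
          (-(((klTransferWeight L M β μ (klFlowFrameU L M β U μ n) n (softSymbolCompl L M β μ (klFlowFrameU L M β U μ n) n j) Qm c - klTransferWeight L M β μ (klFlowFrameU L M β U μ n) n (softSymbolCompl L M β μ (klFlowFrameU L M β U μ n) n j') Qm c : ℝ)) : ℂ))‖ ≤ d c) ∧
        (∀ x y, (ηr x y + mA U * ∑ c, η₁ x c * (d c + ‖(-(((klTransferWeight L M β μ (klFlowFrameU L M β U μ n) n (softSymbolCompl L M β μ (klFlowFrameU L M β U μ n) n j) Qm c - klTransferWeight L M β μ (klFlowFrameU L M β U μ n) n (softSymbolCompl L M β μ (klFlowFrameU L M β U μ n) n j') Qm c : ℝ)) : ℂ))‖) + mA U * mA U * ∑ c, d c + mA U * ∑ c, ‖(-(((klTransferWeight L M β μ (klFlowFrameU L M β U μ n) n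
                    (softSymbolCompl L M β μ (klFlowFrameU L M β U μ n) n j) Qm c - klTransferWeight L M β μ (klFlowFrameU L M β U μ n) n (softSymbolCompl L M β μ (klFlowFrameU L M β U μ n) n j') Qm c : ℝ)) : ℂ))‖ * η₂ c y) ≤ R₀ x y) ∧
        -- a majorant `Φ` of the FUNCTION part of the reorganised analytic majorant (history 4-point rows, localisation rows, (F)(i): owners class #1 / (c) closer / k3c2-p2)
        (∀ x y, R₀ x y + ((klScale klE0 n - klScale klE0 (n + 1)) * (2⁻¹ * Rhd x y) + (Rl₁ x y + Rl₂ x y) + mA U * ∑ c, ((klScale klE0 n - klScale klE0 (n + 1)) * (2⁻¹ * RH₁ x c + ((β * (L : ℝ) ^ 2) ^ 3)⁻¹ * (2 * (M6 * M2 * ((1024 * 15367 : ℝ) / ((klScale klE0 n - klScale klE0 (n + 1)) * ((β * (L : ℝ) ^ 2) ^ 3)⁻¹))))) + RL₁ x c) *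
                (|klTransferWeight L M β μ (klFlowFrameU L M β U μ (n + 1)) (n + 1) (softSymbolCompl L M β μ (klFlowFrameU L M β U μ (n + 1)) (n + 1) j) Qm c - klTransferWeight L M β μ (klFlowFrameU L M β U μ (n + 1)) (n + 1) (softSymbolCompl L M β μ (klFlowFrameU L M β U μ (n + 1)) (n + 1) j') Qm c| +
                  (klBubbleMaj L M β μ (klFlowFrameU L M β U μ (n + 1)) (fun k => (softSymbolCompl L M β μ (klFlowFrameU L M β U μ (n + 1)) (n + 1) j) k - (softSymbolCompl L M β μ (klFlowFrameU L M β U μ (n + 1)) (n + 1) j') k) (softSymbolCompl L M β μ (klFlowFrameU L M β U μ (n + 1)) n (n + 1)) Qm c +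
                    klBubbleMaj L M β μ (klFlowFrameU L M β U μ (n + 1)) (softSymbolCompl L M β μ (klFlowFrameU L M β U μ (n + 1)) n (n + 1)) (fun k => (softSymbolCompl L M β μ (klFlowFrameU L M β U μ (n + 1)) (n + 1) j) k - (softSymbolCompl L M β μ (klFlowFrameU L M β U μ (n + 1)) (n + 1) j') k) Qm c)) +
              mA U * ∑ c, (|klTransferWeight L M β μ (klFlowFrameU L M β U μ (n + 1)) (n + 1) (softSymbolCompl L M β μ (klFlowFrameU L M β U μ (n + 1)) (n + 1) j) Qm c - klTransferWeight L M β μ (klFlowFrameU L M β U μ (n + 1)) (n + 1) (softSymbolCompl L M β μ (klFlowFrameU L M β U μ (n + 1)) (n + 1) j') Qm c| +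
                  (klBubbleMaj L M β μ (klFlowFrameU L M β U μ (n + 1)) (fun k => (softSymbolCompl L M β μ (klFlowFrameU L M β U μ (n + 1)) (n + 1) j) k - (softSymbolCompl L M β μ (klFlowFrameU L M β U μ (n + 1)) (n + 1) j') k) (softSymbolCompl L M β μ (klFlowFrameU L M β U μ (n + 1)) n (n + 1)) Qm c +
                    klBubbleMaj L M β μ (klFlowFrameU L M β U μ (n + 1)) (softSymbolCompl L M β μ (klFlowFrameU L M β U μ (n + 1)) n (n + 1)) (fun k => (softSymbolCompl L M β μ (klFlowFrameU L M β U μ (n + 1)) (n + 1) j) k - (softSymbolCompl L M β μ (klFlowFrameU L M β U μ (n + 1)) (n + 1) j') k) Qm c)) * ((klScale klE0 n - klScale klE0 (n + 1)) * (2⁻¹ * RH₂ c y + ((β * (L : ℝ) ^ 2) ^ 3)⁻¹ * (2 * (M6 * M2 * ((1024 * 15367 : ℝ) / ((klScale klE0 n - klScale klE0 (n + 1)) * ((β * (L : ℝ) ^ 2) ^ 3)⁻¹))))) + RL₂ c y)) ≤ Φ x y) ∧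
        -- (B1) OWNERS' SHARE (φ = 1/2, cell STATUS (R243)): the dressed FUNCTION-part majorant `𝒟[Φ](k,k′)` against the frame slack of the inherited bar plus HALF of three fifths of the ROOM
        (∀ k ∈ klBall L μ 0, ∀ k' ∈ klBall L μ 0, Φ k k' + ∑ c, Φ k c * ρ j' Qm c * (3 / 2 * mA U) + ∑ a', 3 / 2 * mA U * ρ j Qm a' * Φ a' k' + ∑ a', ∑ c, 3 / 2 * mA U * ρ j Qm a' * Φ a' c * ρ j' Qm c * (3 / 2 * mA U) ≤ θ * (((2 : ℝ) ^ (n + 2))⁻¹ * transferBarRelIdx L Gth P r β U n j' Qm k k' + 2⁻¹ * (3 / 5 * (klIdxPrefactor r (n + 1) * ((P.Klam * U) ^ 2 *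
              ((min (klTorusNorm L (k - k') / klScale klE0 (n + 1)) (klScale klE0 (n + 1) / klTorusNorm L (k - k')) + min (klTorusNorm L (k + k' - Qm) / klScale klE0 (n + 1)) (klScale klE0 (n + 1) / klTorusNorm L (k + k' - Qm)) + ((2 : ℝ) ^ n)⁻¹ + 3 * ((L : ℝ))⁻¹) * klIdxMass n j' + ((4 : ℝ) ^ (n + 1))⁻¹ * klIdxOverlap (n + 1) j') +
            ((P.Klam * |U|) ^ 3 * ((2 : ℝ) ^ n)⁻¹ + 3 * thermalBar Gth P U β (n + 1)) * klIdxMass n j'))))) ∧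
        -- (T2)/(T3) THRESHOLD rows of the `min`-slot coefficients (rows (B2)/(B3) discharged by `klbd_scalarRow_direct/crossed_of_sizes`, k3c1-p1 g16 row 89)
        (1 ≤ n → A2s * (1156 * c₄ ^ 2 + 2 ^ 28 * ((4 : ℝ) ^ n)⁻¹ * (e₄ * c₄)) ≤ 9 / 20 * (θ * (r * P.Klam ^ 2))) ∧ (1 ≤ n → A2s * (2712 * c₄ ^ 2 + 2 ^ 27 * ((4 : ℝ) ^ n)⁻¹ * (e₄ * c₄)) ≤ 9 / 20 * (θ * (r * P.Klam ^ 2))) ∧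
        -- (T2p)/(T3p) THRESHOLD rows AT THE PINNED PAIR ((B2″)/(B3″) discharged by `klpp_scalarRow_direct/crossed_pinned_of_sizes`, k3c1-p1 g17)
        (1 ≤ n → j' = n + 1 → A2s * (32855 * c₄ ^ 2 + 2 ^ 28 * ((4 : ℝ) ^ n)⁻¹ * (e₄ * c₄)) + 4 / 15367 * (tD * P.Klam ^ 2) ≤ 9 / 20 * (θ * (r * P.Klam ^ 2))) ∧ (1 ≤ n → j' = n + 1 → A2s * (65709 * c₄ ^ 2 + 2 ^ 27 * ((4 : ℝ) ^ n)⁻¹ * (e₄ * c₄)) + 4 / 15367 * (tX * P.Klam ^ 2) ≤ 9 / 20 * (θ * (r * P.Klam ^ 2))) ∧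
        -- (T4) THRESHOLD rows of the constant part (row (B4) discharged at n = 0 / in the interior / at the crossed top edge by rows 90/91/92; `Ish := 2n+8`, `Iw := 2n+10`)
        (n = 0 → (3220 * sₑ + 136) * c₄ ^ 2 + 2147 * sₑ * (c₆ * c₂) + 3100000 * (e₄ * c₄) + 1031000 * (e₆ * c₂ + c₆ * e₂) ≤ 9 / 20 * (θ * (r * P.Klam ^ 2))) ∧ (1 ≤ n → n + 2 ≤ j' → 608 * (A2s * c₄ ^ 2) + 1 / 3 * c₄ ^ 2 + 860000 * (A2s * c₄ * e₄) + 1550000 * (c₄ * e₄) + 516000 * (c₂ * e₆ + c₆ * e₂) ≤ 9 / 20 * (θ * (r * P.Klam ^ 2))) ∧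
        (1 ≤ n → n + 2 ≤ j' → ¬(n + 3 ≤ nScales β) → 1073 * (sₑ * c₄ ^ 2) ≤ 27 / 80 * (θ * (r * (Gth.CF * P.Klam ^ 2)))) ∧
        -- the EDGE SOFT MASS of the pair's D-line at scale n in index-mass units («(X).3-D-EDGE» pricing, k3c2-p2)
        (0 ≤ klSoftMass L M β μ (klFlowFrameU L M β U μ (n + 1)) n (fun p => softSymbolCompl L M β μ (klFlowFrameU L M β U μ (n + 1)) (n + 1) j p - softSymbolCompl L M β μ (klFlowFrameU L M β U μ (n + 1)) (n + 1) j' p) ∧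
          klSoftMass L M β μ (klFlowFrameU L M β U μ (n + 1)) n (fun p => softSymbolCompl L M β μ (klFlowFrameU L M β U μ (n + 1)) (n + 1) j p - softSymbolCompl L M β μ (klFlowFrameU L M β U μ (n + 1)) (n + 1) j' p) ≤ sₑ * klIdxMass n j') ∧
        -- (B4) RAW at the PINNED pair only (j′ = n+1, n ≥ 1: KNOWN-RISK #3 / located-risk #9 — the signed/split D-line door + class-#1 split data)
        (1 ≤ n → j' = n + 1 →
        (((M4 * M4 * (if 1 ≤ n ∧ n + 2 ≤ j' then 512 / 3 * (27 / (8 * Real.pi ^ 2)) * A2s * (16 * (klScale klE0 j' / klScale klE0 n)) / Real.pi * (10 + 50 * (4 + 8 / 3 * R.Gfr 1 * U ^ 2) * β / L) * (((2 : ℝ) ^ n)⁻¹ / 4) else if 1 ≤ n ∧ j' = n + 1 then 512 / 3 * (27 / (8 * Real.pi ^ 2)) * A2s * (16 * (klScale klE0 j' / klScale klE0 n)) / Real.pi * (10 + 50 * (4 + 8 / 3 * R.Gfr 1 * U ^ 2) * β / L) * (((2 : ℝ) ^ n)⁻¹ / 4) else 2048 * klSoftMass L M β μ (klFlowFrameU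 L M β U μ (n + 1)) n (fun p => softSymbolCompl L M β μ (klFlowFrameU L M β U μ (n + 1)) (n + 1) j p - softSymbolCompl L M β μ (klFlowFrameU L M β U μ (n + 1)) (n + 1) j' p)) + (if 1 ≤ n ∧ j' = n + 1 then (P.Klam * U) ^ 2 * (zD * ((4 : ℝ) ^ (n + 1))⁻¹ + hD * ((4 : ℝ) ^ (nScales β - n))⁻¹ + wD * ((2 : ℝ) ^ n)⁻¹ + lD * ((L : ℝ))⁻¹) else 0) + (η4 * M4 + M4 * η4) * (if n = 0 then (2048 * 15367 : ℝ) else (2048 * 15367 : ℝ) + 512 / 3 * (27 / (8 * Real.pi ^ 2)) * A2s * (16 / Real.pi) * (10 + 50 * (4 + 8 / 3 * R.Gfr 1 * U ^ 2) * β / L) * (Real.sqrt 2 / 4 * ((2 : ℝ) ^ n)⁻¹)) + M4 * M4 * (if 1 ≤ n ∧ n + 2 ≤ j' ∧ n + 3 ≤ nScales β then 256 / 3 * (27 / (8 * Real.pi ^ 2)) * A2s * (16 * (klScale klE0 j' / klScale klE0 n)) / Real.pi * (10 + 50 * (4 + 8 / 3 * R.Gfr 1 * U ^ 2) * β / L)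 * (((2 : ℝ) ^ n)⁻¹ / 4) else if 1 ≤ n ∧ j' = n + 1 then 256 / 3 * (27 / (8 * Real.pi ^ 2)) * A2s * (16 * (klScale klE0 j' / klScale klE0 n)) / Real.pi * (10 + 50 * (4 + 8 / 3 * R.Gfr 1 * U ^ 2) * β / L) * (((2 : ℝ) ^ n)⁻¹ / 4) + (if n + 3 ≤ nScales β then 0 else 1024 * klSoftMass L M β μ (klFlowFrameU L M β U μ (n + 1)) n (fun p => softSymbolCompl L M β μ (klFlowFrameU L M β U μ (n + 1)) (n + 1) j p - softSymbolCompl L M β μ (klFlowFrameU L M β U μ (n + 1)) (n + 1) j' p)) else 1024 * klSoftMass L M β μ (klFlowFrameU L M β U μ (n + 1)) n (fun p => softSymbolCompl L M β μ (klFlowFrameU L M β U μ (n + 1)) (n + 1) j p - softSymbolCompl L M β μ (klFlowFrameU L M β U μ (n + 1)) (n + 1) j' p)) + (if 1 ≤ n ∧ j' = n + 1 ∧ n + 3 ≤ nScales β then (P.Klam * U) ^ 2 * (zX * ((4 : ℝ) ^ (n + 1))⁻¹ + hX * ((4 : ℝ) ^ (nScales β - n))⁻¹ + wX * ((2 : ℝ)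 ^ n)⁻¹ + lX * ((L : ℝ))⁻¹) else 0) + (η4 * M4 + M4 * η4) * (if n = 0 then (1024 * 15367 : ℝ) else (1024 * 15367 : ℝ) + 256 / 3 * (27 / (8 * Real.pi ^ 2)) * A2s * (16 / Real.pi) * (10 + 50 * (4 + 8 / 3 * R.Gfr 1 * U ^ 2) * β / L) * (Real.sqrt 2 / 4 * ((2 : ℝ) ^ n)⁻¹)) +
              2 * (M6 * M2 * (if n + 2 ≤ j' then (0 : ℝ) else 1024 * klSoftMass L M β μ (klFlowFrameU L M β U μ (n + 1)) n (fun p => softSymbolCompl L M β μ (klFlowFrameU L M β U μ (n + 1)) (n + 1) j p - softSymbolCompl L M β μ (klFlowFrameU L M β U μ (n + 1)) (n + 1) j' p)) + (η6 * M2 + M6 * η2) * (1024 * 15367 : ℝ)) +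
              2 * (mA U * (M4 * M4 * (if n = 0 then (2048 * 15367 : ℝ) * (4 * 61524 / Real.pi * ((4 : ℝ) ^ (j' - (n + 1)))⁻¹ * Real.pi) else
                  (2048 * 15367 : ℝ) * (4 * 61524 / Real.pi * ((4 : ℝ) ^ (j' - (n + 1)))⁻¹) * klScale klE0 (n + 1) + 512 / 3 * ((27 / (8 * Real.pi ^ 2)) * A2s * (16 / Real.pi) * (10 + 50 * (4 + 8 / 3 * R.Gfr 1 * U ^ 2) * β / L)) * (Real.sqrt 2 / 4 * ((2 : ℝ) ^ n)⁻¹) * (4 * 61524 / Real.pi * ((4 : ℝ) ^ (j' - (n + 1)))⁻¹ * Real.pi) +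
        2 * (4 * 61524 / Real.pi * ((4 : ℝ) ^ (j' - (n + 1)))⁻¹) * ((512 / 3 * ((27 / (8 * Real.pi ^ 2)) * A2s * (16 / Real.pi) * (10 + 50 * (4 + 8 / 3 * R.Gfr 1 * U ^ 2) * β / L)) * (16384 * (4 + 8 / 3 * R.Gfr 1 * U ^ 2) ^ 2) + (2048 * 15367 : ℝ) / (8 * (4 + 8 / 3 * R.Gfr 1 * U ^ 2))) * klScale klE0 (n + 1)) * (2 * n + 8 : ℕ) +
        (512 / 3 * ((27 / (8 * Real.pi ^ 2)) * A2s * (16 / Real.pi) * (10 + 50 * (4 + 8 / 3 * R.Gfr 1 * U ^ 2) * β / L)) * (16384 * (4 + 8 / 3 * R.Gfr 1 * U ^ 2) ^ 2) + (2048 * 15367 : ℝ) / (8 * (4 + 8 / 3 * R.Gfr 1 * U ^ 2))) * klScale klE0 (n + 1) * (4 * 61524 / Real.pi * ((4 : ℝ) ^ (j' - (n + 1)))⁻¹ * Real.pi) / (klScale klE0 (n + 1) * 2 ^ (2 * n + 8 : ℕ))) + M4 * M4 * (if n = 0 then (1024 * 15367 : ℝ) * (4 * 61524 / Real.pi * ((4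 : ℝ) ^ (j' - (n + 1)))⁻¹ * Real.pi) else
                  (1024 * 15367 : ℝ) * (4 * 61524 / Real.pi * ((4 : ℝ) ^ (j' - (n + 1)))⁻¹) * klScale klE0 (n + 1) + 256 / 3 * ((27 / (8 * Real.pi ^ 2)) * A2s * (16 / Real.pi) * (10 + 50 * (4 + 8 / 3 * R.Gfr 1 * U ^ 2) * β / L)) * (Real.sqrt 2 / 4 * ((2 : ℝ) ^ n)⁻¹) * (4 * 61524 / Real.pi * ((4 : ℝ) ^ (j' - (n + 1)))⁻¹ * Real.pi) +
        2 * (4 * 61524 / Real.pi * ((4 : ℝ) ^ (j' - (n + 1)))⁻¹) * ((256 / 3 * ((27 / (8 * Real.pi ^ 2)) * A2s * (16 / Real.pi) * (10 + 50 * (4 + 8 / 3 * R.Gfr 1 * U ^ 2) * β / L)) * (16384 * (4 + 8 / 3 * R.Gfr 1 * U ^ 2) ^ 2) + (1024 * 15367 : ℝ) / (8 * (4 + 8 / 3 * R.Gfr 1 * U ^ 2))) * klScale klE0 (n + 1)) * (2 * n + 8 : ℕ) +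
        (256 / 3 * ((27 / (8 * Real.pi ^ 2)) * A2s * (16 / Real.pi) * (10 + 50 * (4 + 8 / 3 * R.Gfr 1 * U ^ 2) * β / L)) * (16384 * (4 + 8 / 3 * R.Gfr 1 * U ^ 2) ^ 2) + (1024 * 15367 : ℝ) / (8 * (4 + 8 / 3 * R.Gfr 1 * U ^ 2))) * klScale klE0 (n + 1) * (4 * 61524 / Real.pi * ((4 : ℝ) ^ (j' - (n + 1)))⁻¹ * Real.pi) / (klScale klE0 (n + 1) * 2 ^ (2 * n + 8 : ℕ)))))) * (1 + 3 / 2 * mA U * 738288) * (1 + 3 / 2 * mA U * 738288) +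
            ((M4 * M4 * (if 1 ≤ n ∧ n + 2 ≤ j' then 512 / 3 * (27 / (8 * Real.pi ^ 2)) * A2s * (16 * (klScale klE0 j' / klScale klE0 n)) / Real.pi * (10 + 50 * (4 + 8 / 3 * R.Gfr 1 * U ^ 2) * β / L) * (72 * (4 + 8 / 3 * R.Gfr 1 * U ^ 2) ^ 2) else if 1 ≤ n ∧ j' = n + 1 then 512 / 3 * (27 / (8 * Real.pi ^ 2)) * A2s * (16 * (klScale klE0 j' / klScale klE0 n)) / Real.pi * (10 + 50 * (4 + 8 / 3 * R.Gfr 1 * U ^ 2) * β / L) * (32 * 8 ^ 2 * (4 + 8 / 3 * R.Gfr 1 * U ^ 2) ^ 2) else 0) + (if 1 ≤ n ∧ j' = n + 1 then (P.Klam * U) ^ 2 * tD else 0) + (η4 * M4 + M4 * η4) * (if n = 0 then (0 : ℝ) else 512 / 3 * (27 / (8 * Real.pi ^ 2)) * A2s * (16 / Real.pi) * (10 + 50 * (4 + 8 / 3 * R.Gfr 1 * U ^ 2) * β / L) * (16384 * (4 + 8 / 3 * R.Gfr 1 * U ^ 2) ^ 2))) +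
              (M4 * M4 * (if 1 ≤ n ∧ n + 2 ≤ j' ∧ n + 3 ≤ nScales β then 256 / 3 * (27 / (8 * Real.pi ^ 2)) * A2s * (16 * (klScale klE0 j' / klScale klE0 n)) / Real.pi * (10 + 50 * (4 + 8 / 3 * R.Gfr 1 * U ^ 2) * β / L) * (338 * (4 + 8 / 3 * R.Gfr 1 * U ^ 2) ^ 2) else if 1 ≤ n ∧ j' = n + 1 then 256 / 3 * (27 / (8 * Real.pi ^ 2)) * A2s * (16 * (klScale klE0 j' / klScale klE0 n)) / Real.pi * (10 + 50 * (4 + 8 / 3 * R.Gfr 1 * U ^ 2) * β / L) * (32 * 16 ^ 2 * (4 + 8 / 3 * R.Gfr 1 * U ^ 2) ^ 2) else 0) + (if 1 ≤ n ∧ j' = n + 1 ∧ n + 3 ≤ nScales β then (P.Klam * U) ^ 2 * tX else 0) + (η4 * M4 + M4 * η4) * (if n = 0 then (0 : ℝ) else 256 / 3 * (27 / (8 * Real.pi ^ 2)) * A2s * (16 / Real.pi) * (10 + 50 * (4 + 8 / 3 * R.Gfr 1 * U ^ 2) * β / L) * (16384 * (4 + 8 / 3 * R.Gfr 1 * U ^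 2) ^ 2)))) * ((3 / 2 * mA U) * ((((n + 1 : ℕ) + 2) * (2 * 369144 / Real.pi * klScale klE0 (n + 1) * (1 + 2 * (2 * n + 10 : ℕ)) + 738288 / 2 ^ (2 * n + 10 : ℕ))) +
                (((n + 1 : ℕ) + 2) * (2 * 369144 / Real.pi * klScale klE0 (n + 1) * (1 + 2 * (2 * n + 10 : ℕ)) + 738288 / 2 ^ (2 * n + 10 : ℕ)))) + (3 / 2 * mA U) * (3 / 2 * mA U) * (738288 * (((n + 1 : ℕ) + 2) * (2 * 369144 / Real.pi * klScale klE0 (n + 1) * (1 + 2 * (2 * n + 10 : ℕ)) + 738288 / 2 ^ (2 * n + 10 : ℕ)))))) ≤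
          2⁻¹ * (θ * (3 / 5 * (klIdxPrefactor r (n + 1) * ((P.Klam * U) ^ 2 * ((((2 : ℝ) ^ n)⁻¹ + 3 * ((L : ℝ))⁻¹) * klIdxMass n j' + ((4 : ℝ) ^ (n + 1))⁻¹ * klIdxOverlap (n + 1) j') + ((P.Klam * |U|) ^ 3 * ((2 : ℝ) ^ n)⁻¹ + 3 * thermalBar Gth P U β (n + 1)) * klIdxMass n j'))))))) (hexport : G.WF → ∀ Q : EngConsts, Q₀.IsRaiseOf Q → ∀ cc : ℝ, 0 < cc → cc ≤ klEngC₃6 P R →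
        ∀ μ ∈ klWindowC, ∀ U : ℝ, 0 < U → U ≤ klEngU₀10 P R cc → U ≤ u Q cc → ∀ β : ℝ, klBetaMin ≤ β → β ≤ Real.exp (cc / U ^ 2) → ∀ (L M : ℕ) [NeZero L] [NeZero M], klEngL₄ P R β U ≤ L → klEngM₃ β U L ≤ M → ∀ n : ℕ, n ≤ nScales β + 1 → IsKLRegime U cc (-((n : ℕ) : ℤ)) → HistP klPredsV17F2 L M G P Q R β U μ 0 (n) → FrameOK R U (nScales β) μ (klFlowFrameU L M β U μ (n)) →
                    (∀ j ≤ n, LevelsUExportMixedAt L M (klCU2 P R Q₀) P β U μ j) → ∀ j' : ℕ, n ≤ j' → j' ≤ nScales β + 1 → ∀ Qm : TorusSite 2 L, C L Qm n → ∀ x y, ‖klMemberArrayF L M β U μ n (softSymbolCompl L M β μ (klFlowFrameU L M β U μ n) n j') Qm x y‖ ≤ mA U) : G.WF → ∀ Q : EngConsts, Q₀.IsRaiseOf Q → ∀ cc : ℝ, 0 < cc → cc ≤ klEngC₃6 P R → ∀ μ ∈ klWindowC, ∀ U : ℝ, 0 < U → U ≤ klEngU₀10 P R cc → U ≤ u Q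 cc →
        ∀ β : ℝ, klBetaMin ≤ β → β ≤ Real.exp (cc / U ^ 2) → ∀ (L M : ℕ) [NeZero L] [NeZero M], klEngL₄ P R β U ≤ L → klEngM₃ β U L ≤ M → ∀ n : ℕ, n ≤ nScales β + 1 → IsKLRegime U cc (-(n : ℤ)) → HistP klPredsV17F2 L M G P Q R β U μ 0 n → FrameOK R U (nScales β) μ (klFlowFrameU L M β U μ n) → (∀ j ≤ n, LevelsUExportMixedAt L M (klCU2 P R Q₀) P β U μ j) →
                    ∀ m m' : ℕ, n ≤ m' → m' ≤ m → m ≤ nScales β + 1 → ∀ Qm : TorusSite 2 L, C L Qm n → ∃ N : Matrix (TorusSite 2 L) (TorusSite 2 L) ℂ, (1 - diagonal (fun p => ((klTransferWeight L M β μ (klFlowFrameU L M β U μ n) n (softSymbolCompl L M β μ (klFlowFrameU L M β U μ n) n m) Qm p -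
          klTransferWeight L M β μ (klFlowFrameU L M β U μ n) n (softSymbolCompl L M β μ (klFlowFrameU L M β U μ n) n m') Qm p : ℝ) : ℂ)) * klMemberArrayF L M β U μ n (softSymbolCompl L M β μ (klFlowFrameU L M β U μ n) n m') Qm) * N = 1 ∧ N * (1 - diagonal (fun p => ((klTransferWeight L M β μ (klFlowFrameU L M β U μ n) n (softSymbolCompl L M β μ (klFlowFrameU L M β U μ n) n m) Qm p -
          klTransferWeight L M β μ (klFlowFrameU L M β U μ n) n (softSymbolCompl L M β μ (klFlowFrameU L M β U μ n) n m') Qm p : ℝ) : ℂ)) * klMemberArrayF L M β U μ n (softSymbolCompl L M β μ (klFlowFrameU L M β U μ n) n m') Qm) = 1 ∧ ∀ k ∈ klBall L μ 0, ∀ k' ∈ klBall L μ 0,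
        ‖klMemberArrayF L M β U μ n (softSymbolCompl L M β μ (klFlowFrameU L M β U μ n) n m) Qm k k' - (klMemberArrayF L M β U μ n (softSymbolCompl L M β μ (klFlowFrameU L M β U μ n) n m') Qm * N) k k'‖ ≤ transferBarRelIdx L Gth P r β U n m' Qm k k' := by
  refine pairTransferStep7_of_analytic_resolved_budgetGridSplit_pinned_all C hC mA hR hCF hKl hr hθ0 hθ h0 hmA h2s hA2s hkit hbase ?_ hexport
  intro hG Q hQ cc hcc0 hcc μ hμ U hU hU10 hUu β hβ hβc L M iL iM hL hM n hn hreg hhist hK hlev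
  obtain ⟨hZ, hstep⟩ := hsucc hG Q hQ cc hcc0 hcc μ hμ U hU hU10 hUu β hβ hβc L M hL hM n hn hreg hhist hK hlev
  refine ⟨hZ, fun A A' b b' a ρ V V6 Sg Hd Φ Wd Br hA hA' hb hb' ha hρ hV hV6 hSg hHd hΦ hWd hBr j j' h1 h2 h3 Qm hQm => ?_⟩
  obtain ⟨ηr, η₁, η₂, R₀, Φf, d, M4, M6, M2, η4, η6, η2, c₄, c₆, c₂, e₄, e₆, e₂, sₑ, zD, hD, wD, lD, tD, zX, hX, wX, lX, tX, RH₁, RH₂, Rhd, RL₁, RL₂, Rl₁, Rl₂, Ng,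
    hA₁, hA₂, hN0, hz0, hPD, hPX, hN, hB4, hB6, hB2, hE4, hE6, hE2,
    hM40, hM60, hM20, hη40, hη60, hη20, hc₄, hc₆, hc₂, he₄, he₆, he₂, hsₑ, hM4c, hM6c, hM2c, hη4e, hη6e, hη2e,
    hRH₁, hRH₂, hRhd, hRL₁, hRL₂, hRl₁, hRl₂, hH, hηr, hη₁, hη₂, hd, hR₀, hΦf, hS1, hT2, hT3, hT2p, hT3p, hT40, hT4, hT4th, ⟨hSM0, hSMe⟩, hPIN⟩ :=
    hstep A A' b b' a ρ V V6 Sg Hd Φ Wd Br hA hA' hb hb' ha hρ hV hV6 hSg hHd hΦ hWd hBr j j' h1 h2 h3 Qm hQm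
  -- the regime numbers from the loop's thresholds (as in row 86): `Gfr₁U² ≤ 1`, `8Gβ ≤ L`
  obtain ⟨hm0, hnum⟩ := hmA Q cc U hU hUu
  have hGfr : 0 ≤ R.Gfr 1 := hR.wf.2.2 1
  have hβ0 : 0 < β := pos_of_klBetaMin_le hβ
  have hU1 : U ≤ 1 / (R.Gfr 1 + 1) := hU10.trans (klEngU₀10_le_inv_gfr_add_one P hR.wf cc (j := 1) (by norm_num))
  have hGU : R.Gfr 1 * U ^ 2 ≤ 1 := by
    have h2 : U * (R.Gfr 1 + 1) ≤ 1 := by rwa [le_div_iff₀ (by positivity)] at hU1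
    nlinarith [mul_nonneg hGfr hU.le]
  have h128 : (128 : ℝ) ≤ β := by unfold klBetaMin at hβ; exact hβ
  have hsq : β ^ 2 ≤ (L : ℝ) := sq_le_of_klEngL₃_le (klEngL₃_le_of_klEngL₄_le hL)
  have hGL : 8 * (4 + 8 / 3 * R.Gfr 1 * U ^ 2) * β ≤ L := by nlinarith [mul_le_mul_of_nonneg_right hGU hβ0.le]
  refine ⟨ηr, η₁, η₂, R₀, Φf, d, M4, M6, M2, η4, η6, η2, zD, hD, wD, lD, tD, zX, hX, wX, lX, tX, 2 * n + 8, 2 * n + 10, RH₁, RH₂, Rhd, RL₁, RL₂, Rl₁, Rl₂, Ng,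
    hA₁, hA₂, hN0, hz0, hPD, hPX, hN, hB4, hB6, hB2, hE4, hE6, hE2, hRH₁, hRH₂, hRhd, hRL₁, hRL₂, hRl₁, hRl₂, hH, hηr, hη₁, hη₂, hd, hR₀, hΦf, hS1, ?_, ?_, ?_⟩
  · -- (B2″): at the pinned pair the closer's row; elsewhere the scalar guard is off and row 89 applies
    rcases Nat.eq_zero_or_pos n with hn0 | hn1
    · have hP : ¬(1 ≤ n ∧ j' = n + 1) := fun h => by omega
      simp only [if_neg hP, add_zero]
      exact klbd_scalarRow_direct_zero P R hn0 hθ0 hr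
    · by_cases hpin : j' = n + 1
      · exact klpp_scalarRow_direct_pinned_of_sizes P R hGfr hn1 hpin hA2s hU.le hβ0.le hθ0 hr hc₄ he₄ hM40 hM4c hz0.2.2.2.2.1 hη40 hη4e hGU hGL (hT2p hn1 hpin)
      · have hP : ¬(1 ≤ n ∧ j' = n + 1) := fun h => hpin h.2
        simp only [if_neg hP, add_zero]
        exact klbd_scalarRow_direct_of_sizes P R hGfr hn1 (by omega) hA2s hU.le hβ0.le hθ0 hr hc₄ he₄ hM40 hM4c hη40 hη4e hGU hGL (hT2 hn1)
  · -- (B3″)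
    rcases Nat.eq_zero_or_pos n with hn0 | hn1
    · have hP : ¬(1 ≤ n ∧ j' = n + 1) := fun h => by omega
      have hPB : ¬(1 ≤ n ∧ j' = n + 1 ∧ n + 3 ≤ nScales β) := fun h => by omega
      simp only [if_neg hP, if_neg hPB, add_zero]
      exact klbd_scalarRow_crossed_zero P R hn0 hθ0 hr
    · by_cases hpin : j' = n + 1
      · exact klpp_scalarRow_crossed_pinned_of_sizes P R hGfr hn1 hpin hA2s hU.le hβ0.le hθ0 hr hc₄ he₄ hM40 hM4c hz0.2.2.2.2.2.2.2.2.2 hη40 hη4e hGU hGL (hT3p hn1 hpin)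
      · have hP : ¬(1 ≤ n ∧ j' = n + 1) := fun h => hpin h.2
        have hPB : ¬(1 ≤ n ∧ j' = n + 1 ∧ n + 3 ≤ nScales β) := fun h => hpin h.2.1
        simp only [if_neg hP, if_neg hPB, add_zero]
        exact klbd_scalarRow_crossed_of_sizes P R hGfr hn1 (by omega) hA2s hU.le hβ0.le hθ0 hr hc₄ he₄ hM40 hM4c hη40 hη4e hGU hGL (hT3 hn1)
  · -- (B4): first step / pinned pair / interior / crossed top edge
    rcases Nat.eq_zero_or_pos n with hn0 | hn1
    · have hP : ¬(1 ≤ n ∧ j' = n + 1) := fun h => by omega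
      have hPB : ¬(1 ≤ n ∧ j' = n + 1 ∧ n + 3 ≤ nScales β) := fun h => by omega
      simp only [if_neg hP, if_neg hPB, add_zero]
      exact klbd_scalarRow_const_zero_of_sizes P R hCF hn0 h1 hU.le hθ0 hr hKl hc₄ he₄ hc₆ hc₂ he₆ he₂ hsₑ hM40 hM4c hη40 hη4e hM60 hM6c hM20 hM2c
        hη60 hη6e hη20 hη2e hSM0 hSMe hm0 hnum (hT40 hn0)
    · by_cases hpin : j' = n + 1
      · exact hPIN hn1 hpin
      · have hj2 : n + 2 ≤ j' := by omega
        have hP : ¬(1 ≤ n ∧ j' = n + 1) := fun h => hpin h.2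
        have hPB : ¬(1 ≤ n ∧ j' = n + 1 ∧ n + 3 ≤ nScales β) := fun h => hpin h.2.1
        simp only [if_neg hP, if_neg hPB, add_zero]
        by_cases htop : n + 3 ≤ nScales β
        · exact klbd_scalarRow_const_interior_of_sizes P R hGfr hCF hn1 hj2 htop hA2s hU.le hβ0.le hθ0 hr hKl hc₄ he₄ hc₆ hc₂ he₆ he₂
            hM40 hM4c hη40 hη4e hM60 hM6c hM20 hM2c hη60 hη6e hη20 hη2e hm0 hnum hGU hGL (hT4 hn1 hj2)
        · exact klbd_scalarRow_const_top_of_sizes P R hGfr hCF hn1 hj2 htop hsₑ hSM0 hSMe hA2s hU.le hβ0.le hθ0 hr hKl hc₄ he₄ hc₆ hc₂ he₆ he₂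
            hM40 hM4c hη40 hη4e hM60 hM6c hM20 hM2c hη60 hη6e hη20 hη2e hm0 hnum hGU hGL (hT4 hn1 hj2) (hT4th hn1 hj2 htop)

end ProducerSized

end Summit.HubbardSuperconductivity.HubbardSuperconductivity.Theorems.KLRegimeSplit

end
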